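/-
Origin: expansion seat `planner-pub-hodgecm-mc-glue-1-0`, handover #35 2026-08-18T19:54Z md5 c1ce50291b948779bf4a34006439f888 (NEW additive leaf, 211 l., junction J2g = orthogonality of non-meeting piece embeddings + rationality of pairing translates + adjoint/cross-term/sum formulas for Q.R, generic over HodgeCM.QuotientModel then specialised to the regime (HermSpace3.regimePieceEmb); PKG CLAIM 19:54:17Z window -> 20:04Z; INSTALL ONLY WITH/AFTER rows #33 and #34 (`HOME/mc/pub-hodgecm-mc-glue-1/aslanded/HodgeCM/Model/Junction/PieceOverlap.lean`, md5 c1ce5029, 211 lines);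
landed by the packager successor (mc-unitary-1-g3, gen-8 kit) in gate run 32 as `HodgeCM/Model/Junction/PieceOverlap.lean` (verbatim).
-/
/-
Origin: speedrun cell pub-hodgecm, MODEL-CONSTRUCTION sub-cell, unit pub-hodgecm-mc-glue-1 (node E-J, junction J2g =
pieces that do not meet are orthogonal in `Q.H`; a `Q.R`-translate that pairs with the principal pieces is rational
up to the levels — the entry point of the level-meeting and piece-by-piece computations of the E3, E4 roadmaps),
seat planner-pub-hodgecm-mc-glue-1-0, 2026-08-18.
Target in PKG: HodgeCM/Model/Junction/PieceOverlap.lean (NEW additive leaf; nothing landed imports it).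
P0 NOTE: imports the vendored harness-tree module `LevelOrbitPieceOverlap` (this unit's tree file J2g) under its
vendored name and this unit's junction J2f `RegimeLevelChange`.
-/
import Summits.HodgeConjecture.HodgeCM.Model.Junction.RegimeLevelChange
import Literature.NumberTheory.Automorphic.LevelOrbitPieceOverlap

/-!
# Junction J2g: orthogonality of non-meeting pieces and rationality of pairing translates, read in `Q.H`

* § 1 `Q.R` bookkeeping for distributing a pairing of two sums of translates: `inner_R_left`
  (`⟪R g v', v⟫ = ⟪v', R g⁻¹ v⟫`), `inner_R_R_cross` (`⟪R g' v', R g v⟫ = ⟪v', R (g'⁻¹ g) v⟫`),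
  `inner_sum_R_sum_R` (double-sum expansion).
* § 2 for the piece embedding `Q.pieceEmb Γ₁ e hΓ M π x` (J2c): two pieces `M' • x'`, `M • x` of `G₁ ⧸ Γ₁` that do
  not meet carry ORTHOGONAL embedded classes (`inner_pieceEmb_eq_zero_of_disjoint`, from the tree's
  `LevelOrbit.inner_pieceLiftLp_eq_zero_of_disjoint`); a non-trivial pairing forces `m' • x' = m • x`
  (`exists_smul_eq_of_inner_pieceEmb_ne_zero`); with a translate `Q.R (e g)` it forces `m' • x' = (g m) • x`
  (`exists_smul_eq_of_inner_pieceEmb_R_ne_zero`), and through the PRINCIPAL pieces `x = x' = 1` it forces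
  **`g = m' * γ * m` with `γ ∈ Γ₁`** (`exists_eq_mul_of_inner_pieceEmb_R_ne_zero`; `Q.G`-form `…_R'_…`).
* § 3 the in-regime readings over `V.regimePieceEmb hP h` (END-STATE carrier): `γ ∈ U(V)(L⁺)` is a RATIONAL
  element, so the surviving translate is a Hecke translate (`R_regimePieceEmb`, J2f) up to the levels.

Everything is proved; 0 hypotheses beyond the data (and the standing regime hypotheses `hP`, `h` in § 3);
0 MODEL-N.
-/

set_option autoImplicit false

noncomputable section

open MeasureTheory Literature.MeasureTheory.Group Literature.NumberTheory.Automorphic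
open scoped InnerProductSpace BigOperators

namespace HodgeCM

namespace QuotientModel

/-! ## § 1. `Q.R` bookkeeping -/

/-- **Adjoint formula**: `⟪Q.R g v', v⟫ = ⟪v', Q.R g⁻¹ v⟫` (`Q.R` is unitary, `inner_R_R`). -/
theorem inner_R_left (Q : QuotientModel) (g : Q.G) (v' v : Q.H) : ⟪Q.R g v', v⟫_ℂ = ⟪v', Q.R g⁻¹ v⟫_ℂ := by
  have h1 : Q.R g⁻¹ (Q.R g v') = v' := by
    change (Q.R g⁻¹ * Q.R g) v' = v'
    rw [← map_mul, inv_mul_cancel, map_one]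
    rfl
  rw [← inner_R_R Q g⁻¹ (Q.R g v') v, h1]

/-- **Cross terms**: `⟪Q.R g' v', Q.R g v⟫ = ⟪v', Q.R (g'⁻¹ * g) v⟫`. -/
theorem inner_R_R_cross (Q : QuotientModel) (g' g : Q.G) (v' v : Q.H) :
    ⟪Q.R g' v', Q.R g v⟫_ℂ = ⟪v', Q.R (g'⁻¹ * g) v⟫_ℂ := by
  rw [inner_R_left, map_mul]
  rfl

/-- **Distributing a pairing of two sums of translates**:
`⟪∑ i, R (k' i) v', ∑ j, R (k j) v⟫ = ∑ i, ∑ j, ⟪v', R ((k' i)⁻¹ * k j) v⟫`. -/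
theorem inner_sum_R_sum_R (Q : QuotientModel) {ι ι' : Type*} (s' : Finset ι') (s : Finset ι) (k' : ι' → Q.G)
    (k : ι → Q.G) (v' v : Q.H) :
    ⟪∑ i ∈ s', Q.R (k' i) v', ∑ j ∈ s, Q.R (k j) v⟫_ℂ = ∑ i ∈ s', ∑ j ∈ s, ⟪v', Q.R ((k' i)⁻¹ * k j) v⟫_ℂ := by
  rw [sum_inner]
  refine Finset.sum_congr rfl fun i _ => ?_
  rw [inner_sum]
  exact Finset.sum_congr rfl fun j _ => inner_R_R_cross Q (k' i) (k j) v' v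

/-! ## § 2. Pieces, read in `Q.H` -/

variable (Q : QuotientModel) {G₁ : Type*} [Group G₁] [TopologicalSpace G₁] [IsTopologicalGroup G₁]
  (Γ₁ : Subgroup G₁) (e : G₁ ≃ₜ* Q.G) (hΓ : ∀ g, e g ∈ Q.Γ ↔ g ∈ Γ₁)
  [MeasurableSpace (G₁ ⧸ Γ₁)] [BorelSpace (G₁ ⧸ Γ₁)]
  (M : Subgroup G₁) {A : Type*} [Group A] [TopologicalSpace A] [IsTopologicalGroup A] (π : M →* A)
  (x : G₁ ⧸ Γ₁) [CompactSpace (A ⧸ LevelOrbit.pieceLattice M Γ₁ π x)]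
  (M' : Subgroup G₁) {A' : Type*} [Group A'] [TopologicalSpace A'] (π' : M' →* A')
  (x' : G₁ ⧸ Γ₁) [CompactSpace (A' ⧸ LevelOrbit.pieceLattice M' Γ₁ π' x')]

omit [IsTopologicalGroup A] in
/-- **Pieces that do not meet carry orthogonal classes in `Q.H`** — any two levels, receiving groups,
projections. -/
theorem inner_pieceEmb_eq_zero_of_disjoint (hM : IsOpen (M : Set G₁)) (hπ : Continuous π)
    (hM' : IsOpen (M' : Set G₁)) (hπ' : Continuous π')
    (hdisj : Disjoint (MulAction.orbit M' x') (MulAction.orbit M x))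
    (f' : C(A' ⧸ LevelOrbit.pieceLattice M' Γ₁ π' x', ℂ)) (f : C(A ⧸ LevelOrbit.pieceLattice M Γ₁ π x, ℂ)) :
    ⟪Q.pieceEmb Γ₁ e hΓ M' π' x' hM' hπ' f', Q.pieceEmb Γ₁ e hΓ M π x hM hπ f⟫_ℂ = 0 := by
  rw [pieceEmb_apply, pieceEmb_apply, LinearIsometryEquiv.inner_map_map]
  exact LevelOrbit.inner_pieceLiftLp_eq_zero_of_disjoint ℂ M Γ₁ π x M' π' x' _ hM hπ hM' hπ' hdisj f' f

omit [IsTopologicalGroup A] in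
/-- Read backwards: a non-trivial pairing in `Q.H` forces the pieces to meet, `m' • x' = m • x`. -/
theorem exists_smul_eq_of_inner_pieceEmb_ne_zero (hM : IsOpen (M : Set G₁)) (hπ : Continuous π)
    (hM' : IsOpen (M' : Set G₁)) (hπ' : Continuous π')
    (f' : C(A' ⧸ LevelOrbit.pieceLattice M' Γ₁ π' x', ℂ)) (f : C(A ⧸ LevelOrbit.pieceLattice M Γ₁ π x, ℂ))
    (hne : ⟪Q.pieceEmb Γ₁ e hΓ M' π' x' hM' hπ' f', Q.pieceEmb Γ₁ e hΓ M π x hM hπ f⟫_ℂ ≠ 0) :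
    ∃ (m' : M') (m : M), (m' : G₁) • x' = (m : G₁) • x := by
  rw [← LevelOrbit.not_disjoint_orbit_iff]
  exact fun hdisj => hne (Q.inner_pieceEmb_eq_zero_of_disjoint Γ₁ e hΓ M π x M' π' x' hM hπ hM' hπ' hdisj f' f)

/-- **A translate that pairs forces the pieces to meet through `g`**:
`⟪pieceEmb_{M', x'} f', Q.R (e g) (pieceEmb_{M, x} f)⟫ ≠ 0 ⇒ m' • x' = (g * m) • x`. -/
theorem exists_smul_eq_of_inner_pieceEmb_R_ne_zero (hM : IsOpen (M : Set G₁)) (hπ : Continuous π)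
    (hM' : IsOpen (M' : Set G₁)) (hπ' : Continuous π') (g : G₁)
    (f' : C(A' ⧸ LevelOrbit.pieceLattice M' Γ₁ π' x', ℂ)) (f : C(A ⧸ LevelOrbit.pieceLattice M Γ₁ π x, ℂ))
    (hne : ⟪Q.pieceEmb Γ₁ e hΓ M' π' x' hM' hπ' f', Q.R (e g) (Q.pieceEmb Γ₁ e hΓ M π x hM hπ f)⟫_ℂ ≠ 0) :
    ∃ (m' : M') (m : M), (m' : G₁) • x' = (g * m) • x := by
  rw [Q.pieceEmb_apply Γ₁ e hΓ M π x, ← transportL2_translateLp, pieceEmb_apply,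
    LinearIsometryEquiv.inner_map_map] at hne
  exact LevelOrbit.exists_smul_eq_of_inner_translateLp_ne_zero ℂ M Γ₁ π x M' π' x' _ hM hπ hM' hπ' g f' f hne

/-- The same for a point `g'` of the package group (`g := e⁻¹ g'`). -/
theorem exists_smul_eq_of_inner_pieceEmb_R'_ne_zero (hM : IsOpen (M : Set G₁)) (hπ : Continuous π)
    (hM' : IsOpen (M' : Set G₁)) (hπ' : Continuous π') (g' : Q.G)
    (f' : C(A' ⧸ LevelOrbit.pieceLattice M' Γ₁ π' x', ℂ)) (f : C(A ⧸ LevelOrbit.pieceLattice M Γ₁ π x, ℂ))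
    (hne : ⟪Q.pieceEmb Γ₁ e hΓ M' π' x' hM' hπ' f', Q.R g' (Q.pieceEmb Γ₁ e hΓ M π x hM hπ f)⟫_ℂ ≠ 0) :
    ∃ (m' : M') (m : M), (m' : G₁) • x' = (e.symm g' * m) • x := by
  rw [← e.apply_symm_apply g'] at hne
  exact Q.exists_smul_eq_of_inner_pieceEmb_R_ne_zero Γ₁ e hΓ M π x M' π' x' hM hπ hM' hπ' (e.symm g') f' f hne

/-- **Principal pieces: a translate that pairs is rational up to the levels** —
`⟪pieceEmb_{M', 1} f', Q.R (e g) (pieceEmb_{M, 1} f)⟫ ≠ 0 ⇒ g = m' * γ * m` with `m' ∈ M'`, `γ ∈ Γ₁`, `m ∈ M`. -/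
theorem exists_eq_mul_of_inner_pieceEmb_R_ne_zero
    [CompactSpace (A ⧸ LevelOrbit.pieceLattice M Γ₁ π ((1 : G₁) : G₁ ⧸ Γ₁))]
    [CompactSpace (A' ⧸ LevelOrbit.pieceLattice M' Γ₁ π' ((1 : G₁) : G₁ ⧸ Γ₁))]
    (hM : IsOpen (M : Set G₁)) (hπ : Continuous π) (hM' : IsOpen (M' : Set G₁)) (hπ' : Continuous π')
    (g : G₁) (f' : C(A' ⧸ LevelOrbit.pieceLattice M' Γ₁ π' ((1 : G₁) : G₁ ⧸ Γ₁), ℂ))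
    (f : C(A ⧸ LevelOrbit.pieceLattice M Γ₁ π ((1 : G₁) : G₁ ⧸ Γ₁), ℂ))
    (hne : ⟪Q.pieceEmb Γ₁ e hΓ M' π' _ hM' hπ' f', Q.R (e g) (Q.pieceEmb Γ₁ e hΓ M π _ hM hπ f)⟫_ℂ ≠ 0) :
    ∃ (m' : M') (γ : Γ₁) (m : M), g = m' * γ * m := by
  rw [Q.pieceEmb_apply Γ₁ e hΓ M π _, ← transportL2_translateLp, pieceEmb_apply,
    LinearIsometryEquiv.inner_map_map] at hne
  exact LevelOrbit.exists_eq_mul_of_inner_translateLp_ne_zero ℂ M Γ₁ π M' π' _ hM hπ hM' hπ' g f' f hne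

/-- The same for a point `g'` of the package group: `e⁻¹ g' = m' * γ * m`. -/
theorem exists_eq_mul_of_inner_pieceEmb_R'_ne_zero
    [CompactSpace (A ⧸ LevelOrbit.pieceLattice M Γ₁ π ((1 : G₁) : G₁ ⧸ Γ₁))]
    [CompactSpace (A' ⧸ LevelOrbit.pieceLattice M' Γ₁ π' ((1 : G₁) : G₁ ⧸ Γ₁))]
    (hM : IsOpen (M : Set G₁)) (hπ : Continuous π) (hM' : IsOpen (M' : Set G₁)) (hπ' : Continuous π')
    (g' : Q.G) (f' : C(A' ⧸ LevelOrbit.pieceLattice M' Γ₁ π' ((1 : G₁) : G₁ ⧸ Γ₁), ℂ))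
    (f : C(A ⧸ LevelOrbit.pieceLattice M Γ₁ π ((1 : G₁) : G₁ ⧸ Γ₁), ℂ))
    (hne : ⟪Q.pieceEmb Γ₁ e hΓ M' π' _ hM' hπ' f', Q.R g' (Q.pieceEmb Γ₁ e hΓ M π _ hM hπ f)⟫_ℂ ≠ 0) :
    ∃ (m' : M') (γ : Γ₁) (m : M), e.symm g' = m' * γ * m := by
  rw [← e.apply_symm_apply g'] at hne
  exact Q.exists_eq_mul_of_inner_pieceEmb_R_ne_zero Γ₁ e hΓ M π M' π' hM hπ hM' hπ' (e.symm g') f' f hne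

end QuotientModel

/-! ## § 3. In the regime: the surviving translate is a rational (Hecke) translate up to the levels -/

namespace HermSpace3

open HodgeCM.Adelic

variable (hP : PrintFact_unitaryCompact) {L : CMField} {ι₁ : L →+* ℂ} (V : HermSpace3 L ι₁)
  (h : IsAnisotropic L V.Hm)
  [MeasurableSpace (adelicUnitaryGroup L V.Hm ⧸ adelicUnitaryRat L V.Hm)]
  [BorelSpace (adelicUnitaryGroup L V.Hm ⧸ adelicUnitaryRat L V.Hm)]
  (M : Subgroup (adelicUnitaryGroup L V.Hm)) {A : Type*} [Group A] [TopologicalSpace A] [IsTopologicalGroup A]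
  (π : M →* A) (x : adelicUnitaryGroup L V.Hm ⧸ adelicUnitaryRat L V.Hm)
  [CompactSpace (A ⧸ LevelOrbit.pieceLattice M (adelicUnitaryRat L V.Hm) π x)]
  (M' : Subgroup (adelicUnitaryGroup L V.Hm)) {A' : Type*} [Group A'] [TopologicalSpace A'] (π' : M' →* A')
  (x' : adelicUnitaryGroup L V.Hm ⧸ adelicUnitaryRat L V.Hm)
  [CompactSpace (A' ⧸ LevelOrbit.pieceLattice M' (adelicUnitaryRat L V.Hm) π' x')]

omit [IsTopologicalGroup A] in
/-- Regime pieces that do not meet carry orthogonal classes in the END-STATE carrier. -/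
theorem inner_regimePieceEmb_eq_zero_of_disjoint (hM : IsOpen (M : Set (adelicUnitaryGroup L V.Hm)))
    (hπ : Continuous π) (hM' : IsOpen (M' : Set (adelicUnitaryGroup L V.Hm))) (hπ' : Continuous π')
    (hdisj : Disjoint (MulAction.orbit M' x') (MulAction.orbit M x))
    (f' : C(A' ⧸ LevelOrbit.pieceLattice M' (adelicUnitaryRat L V.Hm) π' x', ℂ))
    (f : C(A ⧸ LevelOrbit.pieceLattice M (adelicUnitaryRat L V.Hm) π x, ℂ)) :
    ⟪V.regimePieceEmb hP h M' π' x' hM' hπ' f', V.regimePieceEmb hP h M π x hM hπ f⟫_ℂ = 0 :=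
  QuotientModel.inner_pieceEmb_eq_zero_of_disjoint _ _ _ _ M π x M' π' x' hM hπ hM' hπ' hdisj f' f

/-- **A regime translate that pairs forces the pieces to meet through `g`.** -/
theorem exists_smul_eq_of_inner_regimePieceEmb_R_ne_zero (hM : IsOpen (M : Set (adelicUnitaryGroup L V.Hm)))
    (hπ : Continuous π) (hM' : IsOpen (M' : Set (adelicUnitaryGroup L V.Hm))) (hπ' : Continuous π')
    (g : adelicUnitaryGroup L V.Hm)
    (f' : C(A' ⧸ LevelOrbit.pieceLattice M' (adelicUnitaryRat L V.Hm) π' x', ℂ))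
    (f : C(A ⧸ LevelOrbit.pieceLattice M (adelicUnitaryRat L V.Hm) π x, ℂ))
    (hne : ⟪V.regimePieceEmb hP h M' π' x' hM' hπ' f',
      (V.latticeModel hP).toQuotientModel.R (regimeEquiv L V.Hm h g) (V.regimePieceEmb hP h M π x hM hπ f)⟫_ℂ ≠
      0) :
    ∃ (m' : M') (m : M), (m' : adelicUnitaryGroup L V.Hm) • x' = (g * m) • x :=
  QuotientModel.exists_smul_eq_of_inner_pieceEmb_R_ne_zero _ _ _ _ M π x M' π' x' hM hπ hM' hπ' g f' f hne

/-- **Principal regime pieces: the translate is a RATIONAL element up to the levels** —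
`g = m' * γ * m` with `γ ∈ U(V)(L⁺) = adelicUnitaryRat`, so `R(g)` is, up to the levels, the Hecke translate
`R(γ)` of `R_regimePieceEmb`. -/
theorem exists_eq_mul_of_inner_regimePieceEmb_R_ne_zero
    [CompactSpace (A ⧸ LevelOrbit.pieceLattice M (adelicUnitaryRat L V.Hm) π
      ((1 : adelicUnitaryGroup L V.Hm) : adelicUnitaryGroup L V.Hm ⧸ adelicUnitaryRat L V.Hm))]
    [CompactSpace (A' ⧸ LevelOrbit.pieceLattice M' (adelicUnitaryRat L V.Hm) π'
      ((1 : adelicUnitaryGroup L V.Hm) : adelicUnitaryGroup L V.Hm ⧸ adelicUnitaryRat L V.Hm))]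
    (hM : IsOpen (M : Set (adelicUnitaryGroup L V.Hm))) (hπ : Continuous π)
    (hM' : IsOpen (M' : Set (adelicUnitaryGroup L V.Hm))) (hπ' : Continuous π') (g : adelicUnitaryGroup L V.Hm)
    (f' : C(A' ⧸ LevelOrbit.pieceLattice M' (adelicUnitaryRat L V.Hm) π'
      ((1 : adelicUnitaryGroup L V.Hm) : adelicUnitaryGroup L V.Hm ⧸ adelicUnitaryRat L V.Hm), ℂ))
    (f : C(A ⧸ LevelOrbit.pieceLattice M (adelicUnitaryRat L V.Hm) π
      ((1 : adelicUnitaryGroup L V.Hm) : adelicUnitaryGroup L V.Hm ⧸ adelicUnitaryRat L V.Hm), ℂ))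
    (hne : ⟪V.regimePieceEmb hP h M' π' _ hM' hπ' f',
      (V.latticeModel hP).toQuotientModel.R (regimeEquiv L V.Hm h g) (V.regimePieceEmb hP h M π _ hM hπ f)⟫_ℂ ≠
      0) :
    ∃ (m' : M') (γ : adelicUnitaryRat L V.Hm) (m : M), g = m' * γ * m :=
  QuotientModel.exists_eq_mul_of_inner_pieceEmb_R_ne_zero _ _ _ _ M π M' π' hM hπ hM' hπ' g f' f hne

end HermSpace3

end HodgeCM

end
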